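import Mathlib.RepresentationTheory.Coinvariants
import Mathlib.LinearAlgebra.Charpoly.ToMatrix
import Literature.NumberTheory.GaloisRepresentations.CoinvariantsQuadraticTwist
import HarnessLib

/-!
# Coinvariants under a finite-index subgroup of a unipotently acting group

Topic `NumberTheory/GaloisRepresentations`; sibling of `CoinvariantsQuadraticTwist{,Ramified}`
(local Artin formalism on inertia **co**invariants, Serre, *Facteurs locaux des fonctions zêta*,
Sém. DPP 1969/70, §2.3).  THEOREMS ONLY (no definition, no named fact).

Let `ρ` be a representation of a group `G` on a vector space `V` over a field `k` of
characteristic `0`, and `I' ≤ I ≤ G` subgroups such that every `σ ∈ I` has a positive power in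
`I'` (e.g. `I'` of finite index in `I`).  If `I` acts **unipotently of echelon `≤ 2`**, i.e.
`(ρ σ - 1)² = 0` for all `σ ∈ I`, then the kernels `⟨ρ(σ)v - v⟩` defining the coinvariants
`V_{I'}` and `V_I` coincide (`ker_comp_subtype_eq_of_forall_pow_mem`): for `u = ρ σ = 1 + N`,
`N² = 0`, one has `u^n - 1 = n N`, so `(u - 1)V = (u^n - 1)V` (`range_pow_sub_one_eq_of_sq_eq_zero`).

This is the piece of linear algebra by which Artin formalism for the Hasse–Weil `L`-function of an
elliptic curve `E/K` under a finite extension `M/K` extends from the unramified places to the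
**ramified places of semistable reduction**: at a place `v` of good (`N = 0`,
Néron–Ogg–Shafarevich) or multiplicative (`N ≠ 0`, `N² = 0`, Tate curve) reduction the inertia
group `I_𝔓 ≤ Γ_K` acts unipotently on `V_ℓ E`, and the inertia group of `M` at `𝔔 ∣ 𝔓` is the
finite-index subgroup `I_𝔓 ∩ Γ_M`, so `(V_ℓ E)_{I_𝔔(M)} = (V_ℓ E)_{I_𝔓}` and
`L_w(E_M, T) = det(1 - Frob_w T ∣ (V_ℓ E)_{I_𝔓})` with `Frob_w ≡ Frob_v^{f(w|v)}`
(Serre–Tate 1968, §2–3; Silverman *AEC* §C.16; see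
`EllipticCurves/ArtinFormalismSemistableLocalProofs`).  Also provided, for that transport:

* `map_ker_comp_subtype_eq_of_equiv` — along an equivariant isomorphism `E : V' ≃ V` over
  `f : G' → G` the kernel for `S' ≤ G'` is carried onto the kernel for `f(S') ≤ G` (no normality);
* `charpoly_toCoinvariants_eq_of_map_ker_eq` — if moreover that image kernel equals the kernel for
  a normal subgroup `S ⊴ G` (e.g. by the lemma above), then `g'` on `V'_{S'}` and `f g'` on `V_S`
  have the same characteristic polynomial (the tree's `charpoly_toCoinvariants_eq_of_equiv` is the
  case `S = f(S')`);
* `charpoly_toCoinvariants_eq_of_equiv_of_forall_pow_mem` — the two combined.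

## References

* J.-P. Serre, *Facteurs locaux des fonctions zêta des variétés algébriques*, Sém.
  Delange–Pisot–Poitou 1969/70, exp. 19, §2.3; J.-P. Serre, J. Tate, *Good reduction of abelian
  varieties*, Ann. of Math. 88 (1968), §2–3. [SerreTate1968]
* J. Neukirch, *Algebraic Number Theory* (1999), VII §10, proof of (10.4) (iv). [NeukirchANT1999]
-/

noncomputable section

open Polynomial Literature.RepresentationTheory.Semisimple

namespace Literature.NumberTheory.GaloisRepresentations

universe u v w

/-! ### Unipotent endomorphisms of echelon two -/

section Unipotent

variable {k : Type u} [Field k] {V : Type w} [AddCommGroup V] [Module k V]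

/-- **`(u^n - 1)V = (u - 1)V` for a unipotent `u` of echelon two.**  If `(u - 1)² = 0` and `n ≠ 0`
in the field `k` of characteristic `0`, then `u^n - 1 = n (u - 1)` (binomial theorem with two
surviving terms, cf. the tree's `one_add_pow_eq_of_mul_self_eq_zero` of
`EllipticCurves/TateModuleUnipotentInertiaProofs`) has the same image as `u - 1`. [folklore] -/
theorem range_pow_sub_one_eq_of_sq_eq_zero [CharZero k] {u : Module.End k V}
    (hu : (u - 1) * (u - 1) = 0) {n : ℕ} (hn : n ≠ 0) :
    LinearMap.range (u ^ n - 1) = LinearMap.range (u - 1) := by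
  -- `(1 + N)^m = 1 + m N` for `N = u - 1`
  have hbin : ∀ m : ℕ, (1 + (u - 1)) ^ m = 1 + (m : Module.End k V) * (u - 1) := by
    intro m
    induction m with
    | zero => simp
    | succ m ih =>
      rw [pow_succ, ih, add_mul, one_mul, mul_add, mul_one, mul_assoc, hu, mul_zero, add_zero,
        Nat.cast_succ, add_mul, one_mul]
      abel
  have h1 : u ^ n - 1 = (n : Module.End k V) * (u - 1) := by
    have h := hbin n
    rw [add_sub_cancel] at h
    rw [h, add_sub_cancel_left]
  have h2 : (n : Module.End k V) * (u - 1) = (n : k) • (u - 1) := by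
    ext v
    rw [Module.End.mul_apply, Module.End.natCast_apply, LinearMap.smul_apply, Nat.cast_smul_eq_nsmul]
  rw [h1, h2, LinearMap.range_smul _ _ (Nat.cast_ne_zero.mpr hn)]

end Unipotent

/-! ### Coinvariants under `I' ≤ I` when `I` acts unipotently -/

section Kernel

variable {k : Type u} [Field k] {G : Type v} [Group G] {V : Type w} [AddCommGroup V]
  [Module k V]

/-- **Coinvariants under a cofinal subgroup of a unipotently acting group.**  Let `I' ≤ I ≤ G`,
suppose every `σ ∈ I` has a power `σ^n ∈ I'` with `n ≠ 0`, and that `I` acts on `V` through `ρ`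
unipotently of echelon two, `(ρ σ - 1)² = 0` for `σ ∈ I` (characteristic `0`).  Then the kernels
`⟨ρ(σ) v - v⟩` of `V → V_{I'}` and `V → V_I` coincide, i.e. `V_{I'} = V_I`.  With `I = I_𝔓` the
inertia group of `K` at a place of semistable reduction of an elliptic curve `E/K` and
`I' = I_𝔓 ∩ Γ_M` the inertia group of a finite extension `M`, this is
`(V_ℓ E)_{I_𝔔(M)} = (V_ℓ E)_{I_𝔓}` (Serre–Tate 1968 §3; Silverman *AEC* §C.16).
[cite: SerreTate1968, §3] -/
theorem ker_comp_subtype_eq_of_forall_pow_mem [CharZero k] (ρ : Representation k G V)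
    {I I' : Subgroup G} (hle : I' ≤ I) (hpow : ∀ σ ∈ I, ∃ n : ℕ, n ≠ 0 ∧ σ ^ n ∈ I')
    (hunip : ∀ σ ∈ I, (ρ σ - 1) * (ρ σ - 1) = 0) :
    Representation.Coinvariants.ker (ρ.comp I'.subtype) =
      Representation.Coinvariants.ker (ρ.comp I.subtype) := by
  refine le_antisymm (ker_comp_subtype_mono ρ hle) (Submodule.span_le.2 ?_)
  rintro _ ⟨⟨σ, x⟩, rfl⟩
  simp only [comp_subtype_apply, SetLike.mem_coe]
  obtain ⟨n, hn, hσn⟩ := hpow σ σ.2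
  have hx : ρ (σ : G) x - x ∈ LinearMap.range (ρ (σ : G) ^ n - 1) := by
    rw [range_pow_sub_one_eq_of_sq_eq_zero (hunip σ σ.2) hn]
    exact ⟨x, by simp [LinearMap.sub_apply]⟩
  obtain ⟨y, hy⟩ := hx
  rw [← hy, ← map_pow]
  simpa [LinearMap.sub_apply] using sub_mem_ker_comp_subtype ρ hσn y

end Kernel

/-! ### Transport along an equivariant isomorphism -/

section Transport

variable {k : Type u} [Field k] {G : Type v} [Group G] {G' : Type*} [Group G']
  {V : Type w} [AddCommGroup V] [Module k V]
  {V' : Type*} [AddCommGroup V'] [Module k V']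

/-- **Kernels of coinvariants along an equivariant isomorphism.**  Let `f : G' → G` be a group
homomorphism and `E : V' ≃ V` a linear isomorphism intertwining `ρ'` with `ρ ∘ f`.  Then for every
subgroup `S' ≤ G'`, `E` carries `⟨ρ'(s')x - x ∣ s' ∈ S'⟩` onto `⟨ρ(s)v - v ∣ s ∈ f(S')⟩` (no
normality is needed).  [folklore] -/
theorem map_ker_comp_subtype_eq_of_equiv (ρ : Representation k G V)
    (ρ' : Representation k G' V') (f : G' →* G) (E : V' ≃ₗ[k] V)
    (hE : ∀ (g' : G') (x : V'), E (ρ' g' x) = ρ (f g') (E x)) (S' : Subgroup G') :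
    (Representation.Coinvariants.ker (ρ'.comp S'.subtype)).map (E : V' →ₗ[k] V) =
      Representation.Coinvariants.ker (ρ.comp (S'.map f).subtype) := by
  unfold Representation.Coinvariants.ker
  rw [Submodule.map_span]
  congr 1
  ext v
  simp only [Set.mem_image, Set.mem_range, Prod.exists, comp_subtype_apply]
  constructor
  · rintro ⟨_, ⟨s', x, rfl⟩, rfl⟩
    refine ⟨⟨f s', Subgroup.mem_map_of_mem f s'.2⟩, E x, ?_⟩
    simp only [map_sub, LinearEquiv.coe_coe, hE]
  · rintro ⟨s, v, rfl⟩
    obtain ⟨s', hs', hs'eq⟩ := Subgroup.mem_map.1 s.2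
    refine ⟨ρ' s' (E.symm v) - E.symm v, ⟨⟨s', hs'⟩, E.symm v, rfl⟩, ?_⟩
    simp only [map_sub, LinearEquiv.coe_coe, hE, LinearEquiv.apply_symm_apply, hs'eq]

variable [FiniteDimensional k V] [FiniteDimensional k V']

/-- **Characteristic polynomials on coinvariants from an equality of kernels.**  Let `f : G' → G`,
`E : V' ≃ V` intertwine `ρ'` with `ρ ∘ f`, and let `S ⊴ G`, `S' ⊴ G'` be normal subgroups such that
`E` carries the kernel of `V' → V'_{S'}` onto the kernel of `V → V_S`.  Then for every `g' ∈ G'`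
the action of `g'` on `V'_{S'}` and that of `f g'` on `V_S` have the same characteristic
polynomial (`E` descends to `V'_{S'} ≃ V_S`).  The tree's `charpoly_toCoinvariants_eq_of_equiv`
(`CoinvariantsQuadraticTwistRamified`) is the case `S = f(S')`; here `S` may be larger, as for the
inertia groups `f(I_𝔔) = I_𝔓 ∩ Γ_M < I_𝔓` at a ramified place. [folklore] -/
theorem charpoly_toCoinvariants_eq_of_map_ker_eq (ρ : Representation k G V)
    (ρ' : Representation k G' V') (f : G' →* G) (E : V' ≃ₗ[k] V)
    (hE : ∀ (g' : G') (x : V'), E (ρ' g' x) = ρ (f g') (E x))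
    (S : Subgroup G) [S.Normal] (S' : Subgroup G') [S'.Normal]
    (hmap : (Representation.Coinvariants.ker (ρ'.comp S'.subtype)).map (E : V' →ₗ[k] V) =
      Representation.Coinvariants.ker (ρ.comp S.subtype)) (g' : G') :
    (ρ'.toCoinvariants S' g').charpoly = (ρ.toCoinvariants S (f g')).charpoly := by
  refine charpoly_eq_of_semiconj (Submodule.Quotient.equiv _ _ E hmap) fun x => ?_
  induction x using Submodule.Quotient.induction_on with
  | H v =>
    change Submodule.Quotient.equiv _ _ E hmap (Submodule.Quotient.mk (ρ' g' v)) =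
      ρ.toCoinvariants S (f g') (Submodule.Quotient.equiv _ _ E hmap (Submodule.Quotient.mk v))
    rw [Submodule.Quotient.equiv_apply, Submodule.Quotient.equiv_apply, Submodule.mapQ_apply,
      Submodule.mapQ_apply]
    change Submodule.Quotient.mk (E (ρ' g' v)) = Submodule.Quotient.mk (ρ (f g') (E v))
    rw [hE]

/-- **Transport of coinvariants to a larger unipotently acting subgroup.**  Let `f : G' → G`,
`E : V' ≃ V` intertwine `ρ'` with `ρ ∘ f`, let `S' ⊴ G'` and `S ⊴ G` be normal with `f(S') ≤ S`,
every `σ ∈ S` having a power `σ^n ∈ f(S')`, `n ≠ 0`, and `S` acting unipotently of echelon two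
(`(ρ σ - 1)² = 0`, characteristic `0`).  Then `g'` on `V'_{S'}` and `f g'` on `V_S` have the same
characteristic polynomial.  Used with `f` the restriction `D_𝔔 → D_𝔓` of `Γ_M → Γ_K` on
decomposition groups, `S' = I_𝔔`, `S = I_𝔓`, `V' = V_ℓ(E_M) ≅ V_ℓ(E) = V` at a place of
semistable reduction (Serre–Tate 1968 §3). [cite: SerreTate1968, §3] -/
theorem charpoly_toCoinvariants_eq_of_equiv_of_forall_pow_mem [CharZero k]
    (ρ : Representation k G V) (ρ' : Representation k G' V') (f : G' →* G) (E : V' ≃ₗ[k] V)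
    (hE : ∀ (g' : G') (x : V'), E (ρ' g' x) = ρ (f g') (E x))
    (S : Subgroup G) [S.Normal] (S' : Subgroup G') [S'.Normal] (hle : S'.map f ≤ S)
    (hpow : ∀ σ ∈ S, ∃ n : ℕ, n ≠ 0 ∧ σ ^ n ∈ S'.map f)
    (hunip : ∀ σ ∈ S, (ρ σ - 1) * (ρ σ - 1) = 0) (g' : G') :
    (ρ'.toCoinvariants S' g').charpoly = (ρ.toCoinvariants S (f g')).charpoly :=
  charpoly_toCoinvariants_eq_of_map_ker_eq ρ ρ' f E hE S S'
    ((map_ker_comp_subtype_eq_of_equiv ρ ρ' f E hE S').trans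
      (ker_comp_subtype_eq_of_forall_pow_mem ρ hle hpow hunip)) g'

end Transport

end Literature.NumberTheory.GaloisRepresentations
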